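import Summits.QuantumFields.YangMills.Theorems.BalabanUVNodesN11Thm2Ineq249AtRecord13CoPHOfSect3Sentences
import Summits.QuantumFields.YangMills.Theorems.BalabanUVNodesN11Thm2BSideOfIneq242AtRecord13CoPH

/-!
# DAG node N11 — (2.49) FOR THE EFFECTIVE ACTION OF RECORD WITH THE 𝐁-SIDE FROM r11's INDUCTIVE BOUND (2.42): the capstone `…OfSect3Sentences` with both p. 263 counts
# discharged (files 9, 10) AND the boundary-term input downgraded from «(2.47) per class» to (2.42) termwise by ring anchoring (file 12)

Cell `pub-ymgap`, YM-PLAN Track A (HUMAN RULING D-0062 ∕ D-0149), seat `pub-ymgap-dag-n11-w2` (g0), route `BalabanUVNodes`, key item K1⁷ `StabilityBAtRecordR13SepCoPH` =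
stmt-QuantumFields-20542 (helper, count-neutral).  [III] = [Balaban1988Convergent], [II] = [Balaban1988RG2Cluster], [I] = [Balaban1987RG1].  Companion of this seat's file 11
(`…Thm2Ineq249AtRecord13CoPHOfSect3Analysis`, volumes `|Γ_n(s)|`, 𝐁-side (2.47) per class) and file 12 (`…Thm2BSideOfIneq242AtRecord13CoPH`).

WHAT THIS FILE PROVES (0 `sorry`, 0 `def`, standard axioms; count-neutral; nothing of Bałaban's asserted — every analytic sentence is a HYPOTHESIS, displayed).
★★★ `ineq249_action23_at_record₁₃CoPH_of_sect3Analysis_of_ineq242`: for a run `p`, a history `s` (`k ≤ K`), an exposed §2 witness `t`, `a`, `E_k = EkLog + EkRest`, `U`, `1 ≤ θ.τ9.M`: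
FROM (𝐄) the partition (3.65) with support `Z_j ⊂ Ω_j(s)`-points and (3.67) per point (scale-free form); (𝐑) a chosen cube per (2.30)-domain inside `Γ_{sc}(s)` and p. 283's
per-domain bound, `κ ≥ κ₀(4·2^d, 2d)`; (𝐁) r11's INDUCTIVE BOUND (2.42) `|Re 𝐁^{(j)}(X,(ιU,0),A)| ≤ B₀e^{−κ_B d_j(X)}` termwise on the (2.41)(i) range, `κ_B ≥ κ₀(4·2^d, 2d)`; the vacuum
sentence at the volumes `Γ′`; the β-window letters — TO `Ineq249 (action23 …) (A(1∕g_k²(·),U)) (−EkLog) (cE(1−F.L^{−(1−b)})⁻¹ + 1 + 2B₀K₀(4·2^d,2d) + E₂) Γ′ k` with the volumes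
`Γ′_n := |Γ_n(s)| + #ring_n(s)` (`|Γ_n(s)|` = p. 263's point count of `Γ_n(s) ⊂ T₁^{(n)}`; `#ring_n(s)` = file 12's anchor ring of scale `n`, written out).  The p. 263 counts
(files 9, 10, weakened to `Γ′ ≥ |Γ_n(s)|`), [II] (1.26) on the torus and the anchor existence are THEOREMS; (2.47)–(2.48) are no longer inputs.

LOCATED (said in file 12): print's (2.47) charges the boundary terms to `|Γ_n|` using (2.3)'s boundary separations, which the record's admissibility `Chain21` does not carry — hence
the second summand `#ring_n(s)` of `Γ′`; under print's separations `ring_n ⊂ Γ_n` and `Γ′ ≤ 2|Γ_n|`.  HONEST FRAMING.  What stays hypothesis: [III] §3's analysis of 𝐄 and 𝐑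
at the objects of record, r11's inductive hypothesis (2.42) at the configuration, the vacuum sentence, the DAG's unprinted β lower bound, print's «g sufficiently small»; the
junction to N13's Cor.-3 binder stays N13's ∕ def-T's.  N11 NOT discharged; K1⁷ NOT closed; counts unmoved (typed 28∕28 · discharged 5∕27).  One finite four-torus programme
at fixed `ε = L^{−K}`; R4 closes only the conditional finite-𝕋⁴ rung `BalabanLadder.UV`; NOT ℝ⁴, NOT OS, NOT the Yang–Mills mass gap (Clay), which none of this proves.
Sources: [III] (2.40)–(2.42) p.261, (2.43)–(2.49) pp.263–264, (3.65)–(3.67) p.283, p.283, (2.1)–(2.3) pp.254–255; [II] (1.26) p.8; [I] (0.20) p.256, p.257.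
-/

noncomputable section

open scoped BigOperators Matrix.Norms.L2Operator

namespace Summit.QuantumFields.YangMills.Theorems.BalabanUVNodesN11Thm2Ineq249AtRecord13CoPHOfIneq242

open Literature.MathematicalPhysics.QuantumFieldTheory.Balaban1983to89 Step B12TreeDecay TreeLengthTorus B14.Eq225Concrete B14.LocalCoupling B14Thm2 Finset
open T4Continuum
open Node00 hiding blockIter
open FlowStepRuns (genFlow)
open B15DeterminingSets (gammaRegion)
open B10Eq38TorusDomains (toFine)
open B14.Eq213MaximalDomains (side)
open BalabanUVNodesN11Thm2Ineq249AtRecord13CoPHOfSect3Sentences (ineq249_action23_at_record₁₃CoPH_of_sect3Sentences)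
open BalabanUVNodesN11Thm2PointCountAtRecord13CoPH (hcount_at_record₁₃ exists_scale_of_mem_Omega)
open BalabanUVNodesN11Thm2CubeCountAtRecord13CoPH (hcountR_at_record₁₃)
open BalabanUVNodesN11Thm2BSideOfIneq242AtRecord13CoPH (bScale_abs_le_ringCard_of_ineq242)

variable {F : T4Family} {N : ℕ} [NeZero N]
variable (θ : Stage13HParams F N) (p : B12.RunParams) {k : ℕ}

open Classical in
/-- **★★★ (2.49) FOR THE (2.23)-ACTION OF RECORD FROM [III]'s §3 ANALYSIS OF 𝐄 AND 𝐑, r11's INDUCTIVE BOUND (2.42) ON 𝐁, THE VACUUM SENTENCE AND THE WINDOW LETTERS — p. 263 COUNTS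
DISCHARGED, THE 𝐁-SIDE BY RING ANCHORING** (volumes `Γ′_n := |Γ_n(s)| + #ring_n(s)`, block size `F.L`, 𝐁-constant `B₁ := B₀·K₀(4·2^d, 2d)`): the 𝐁-side input is (2.42) termwise at
the record's `t.B j X` (file 12's `bScale_abs_le_ringCard_of_ineq242` in the diagonal decomposition), no longer the Theorem-2-proof sentence (2.47).
[cite: Balaban1988Convergent, (2.42) p.261, (2.43)–(2.49) pp.263–264, (3.65)–(3.67) p.283, p.283, (2.1)–(2.2) pp.254–255; Balaban1988RG2Cluster, (1.26) p.8; Balaban1987RG1, (0.20) p.256] -/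
theorem ineq249_action23_at_record₁₃CoPH_of_sect3Analysis_of_ineq242 (s : SeqOfRecord F θ.ν θ.τ9.M (gOfRecord₁₃ F N θ.toStage13Params p) p.K k) (hkK : k ≤ p.K)
    (hM : 1 ≤ θ.τ9.M) (t : Sect2.TermValues (F.P p.K) (MatA N) (FluctV N) θ.τ9.M) (a : Tk.SFluct (F.P p.K) (FluctV N)) (κ₀ : ℕ) (hκ : 7 ≤ κ₀)
    (Ek EkLog EkRest : ℝ) (hEk : Ek = EkLog + EkRest) (U : GaugeField (F.P p.K) 0 (SU N)) (cE cR b E₂ : ℝ)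
    (hb : b < 1) (hcE : 0 ≤ cE) (hcR : 0 ≤ cR)
    {γ b' : ℝ} {K' : ℕ} (hb' : 0 < b') (hγ4 : γ ^ 4 ≤ b') (hγ2 : γ ≤ 1 / 2)
    (hRγ : (cR * K₀ (4 * 2 ^ (F.P p.K).d) (2 * (F.P p.K).d)) * γ ^ (κ₀ - 6) ≤ 1)
    (hI : (genFlow (betaOfRecord₁₃ F N θ.toStage13Params) p.g0).InInterval γ K')
    (hlb : ∀ j, j < K' → b' ≤ 1 / gOfRecord₁₃ F N θ.toStage13Params p j ^ 2 - 1 / gOfRecord₁₃ F N θ.toStage13Params p (j + 1) ^ 2) (hk : k ≤ K')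
    -- (𝐄)
    (Z : (j : ℕ) → Finset (Site (F.P p.K) j)) (h : (j : ℕ) → Site (F.P p.K) j → Plaq (F.P p.K) 0 → ℝ)
    (hφ : ∀ j, 1 ≤ j → j ≤ k → ∀ q, θ.Phih p k s.Ω s.Λ j q = ∑ z ∈ Z j, h j z q)
    (hZ : ∀ j, 1 ≤ j → j ≤ k → ∀ z, z ∉ Z j → ∀ X, Sect2.admE (F.P p.K) θ.ν θ.τ9.M (gOfRecord₁₃ F N θ.toStage13Params p) s.Λ j (Sect2.domSites (F.P p.K) θ.τ9.M j X) z = false)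
    (hZΩ : ∀ j, 1 ≤ j → j ≤ k → ∀ z ∈ Z j, toFine j z ∈ s.Ω j)
    (h367 : ∀ j, 1 ≤ j → j ≤ k → ∀ z ∈ Z j, ∀ n, j ≤ n → n ≤ k → toFine j z ∈ gammaRegion s.Ω k n →
      |(∑ X : (Sect2.domSys (F.P p.K) θ.τ9.M j).Dom,
        (if Sect2.admE (F.P p.K) θ.ν θ.τ9.M (gOfRecord₁₃ F N θ.toStage13Params p) s.Λ j (Sect2.domSites (F.P p.K) θ.τ9.M j X) z then
          ((t.E j X z (gOfRecord₁₃ F N θ.toStage13Params p (j - 1)) (Sect2.ofBackgroundC (ιSU N) U)).re -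
            (t.E j X z (gOfRecord₁₃ F N θ.toStage13Params p (j - 1)) (Sect2.ofBackgroundC (ιSU N) 1)).re) else 0))
        - (1 / gOfRecord₁₃ F N θ.toStage13Params p (j - 1) ^ 2 - 1 / gOfRecord₁₃ F N θ.toStage13Params p j ^ 2) * smearedWilson (h j z) U| ≤
        cE * (((F.P p.K).L : ℝ) ^ ((j : ℝ) - n)) ^ (5 - b))
    -- (𝐑)
    {κ : ℝ} (hκR : kappa₀ (4 * 2 ^ (F.P p.K).d) (2 * (F.P p.K).d) ≤ κ)
    (pick : (j : ℕ) → (Sect2.domSys (F.P p.K) θ.τ9.M j).Dom → TPt (F.P p.K).d (Sect2.domCount (F.P p.K) θ.τ9.M j))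
    (hpick : ∀ j, 1 ≤ j → j ≤ k → ∀ X, Sect2.admR (F.P p.K) θ.ν θ.τ9.M (gOfRecord₁₃ F N θ.toStage13Params p) s.Λ j (Sect2.domSites (F.P p.K) θ.τ9.M j X) = true → pick j X ∈ X.1)
    (scR : (j : ℕ) → TPt (F.P p.K).d (Sect2.domCount (F.P p.K) θ.τ9.M j) → ℕ)
    (hscR : ∀ j, 1 ≤ j → j ≤ k → ∀ X, Sect2.admR (F.P p.K) θ.ν θ.τ9.M (gOfRecord₁₃ F N θ.toStage13Params p) s.Λ j (Sect2.domSites (F.P p.K) θ.τ9.M j X) = true →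
      (j ≤ scR j (pick j X) ∧ scR j (pick j X) ≤ k) ∧
        cubeEnl (F.P p.K) (side (F.P p.K).L θ.τ9.M j) (Sect2.liftIdx (F.P p.K) (pick j X)) 0 ⊆ gammaRegion s.Ω k (scR j (pick j X)))
    (hr : ∀ j, 1 ≤ j → j ≤ k → ∀ X, Sect2.admR (F.P p.K) θ.ν θ.τ9.M (gOfRecord₁₃ F N θ.toStage13Params p) s.Λ j (Sect2.domSites (F.P p.K) θ.τ9.M j X) = true →
      |(t.R j X (Sect2.ofBackgroundC (ιSU N) U)).re - (t.R j X (Sect2.ofBackgroundC (ιSU N) 1)).re| ≤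
        cR * (((F.P p.K).L : ℝ) ^ ((j : ℝ) - scR j (pick j X))) ^ 4 * (gOfRecord₁₃ F N θ.toStage13Params p j) ^ κ₀ * Real.exp (-κ * (Sect2.domSys (F.P p.K) θ.τ9.M j).dj X))
    -- (𝐁) — r11's inductive bound (2.42) termwise at the record's 𝐁-terms
    {κB B₀ : ℝ} (hκB : kappa₀ (4 * 2 ^ (F.P p.K).d) (2 * (F.P p.K).d) ≤ κB) (hB₀ : 0 ≤ B₀)
    (h242 : ∀ j, 1 ≤ j → j ≤ k → ∀ X, Sect2.admB (F.P p.K) θ.ν θ.τ9.M (gOfRecord₁₃ F N θ.toStage13Params p) s.Ω s.Λ j (Sect2.domSites (F.P p.K) θ.τ9.M j X) = true →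
      |(t.B j X (Sect2.ofBackgroundC (ιSU N) U) a).re| ≤ B₀ * Real.exp (-κB * (Sect2.domSys (F.P p.K) θ.τ9.M j).dj X))
    -- vacuum
    (hvac : VacuumRestBound EkRest E₂ (fun n => ((univ.filter fun y : Site (F.P p.K) n => toFine n y ∈ gammaRegion s.Ω k n).card : ℝ)
        + ((univ.filter fun c : TPt (F.P p.K).d (Sect2.domCount (F.P p.K) θ.τ9.M n) =>
          (Sect2.domSites (F.P p.K) θ.τ9.M n (Sect2.cubeDom (F.P p.K) θ.τ9.M n c) ∩
              Sect2.enlT (F.P p.K) (Sect2.zSide (F.P p.K) θ.ν θ.τ9.M (gOfRecord₁₃ F N θ.toStage13Params p) n) 1 (s.Λ n)ᶜ).Nonempty ∧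
            ∃ c', (c' = c ∨ TAdj c' c) ∧ (Sect2.domSites (F.P p.K) θ.τ9.M n (Sect2.cubeDom (F.P p.K) θ.τ9.M n c') ∩ s.Ω n).Nonempty).card : ℝ)) k) :
    Ineq249 ((sect2ActionDataOfRecord F N (FluctV N) p.K (settingOfRecord₁₃ F N θ.toStage13Params p) (θ.rzAt p s) s t a Ek).action23 k U)
      (smearedWilson (invSq (flowOfRun (gOfRecord₁₃ F N θ.toStage13Params p)) (θ.Phih p k s.Ω s.Λ) k) U) (-EkLog)
      (cE * (1 - ((F.P p.K).L : ℝ) ^ (-(1 - b)))⁻¹ + 1 + 2 * (B₀ * K₀ (4 * 2 ^ (F.P p.K).d) (2 * (F.P p.K).d)) + E₂)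
      (fun n => ((univ.filter fun y : Site (F.P p.K) n => toFine n y ∈ gammaRegion s.Ω k n).card : ℝ)
        + ((univ.filter fun c : TPt (F.P p.K).d (Sect2.domCount (F.P p.K) θ.τ9.M n) =>
          (Sect2.domSites (F.P p.K) θ.τ9.M n (Sect2.cubeDom (F.P p.K) θ.τ9.M n c) ∩
              Sect2.enlT (F.P p.K) (Sect2.zSide (F.P p.K) θ.ν θ.τ9.M (gOfRecord₁₃ F N θ.toStage13Params p) n) 1 (s.Λ n)ᶜ).Nonempty ∧
            ∃ c', (c' = c ∨ TAdj c' c) ∧ (Sect2.domSites (F.P p.K) θ.τ9.M n (Sect2.cubeDom (F.P p.K) θ.τ9.M n c') ∩ s.Ω n).Nonempty).card : ℝ)) k := by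
  have hL : (1 : ℝ) < ((F.P p.K).L : ℝ) := by exact_mod_cast (F.P p.K).hL.2
  have hkmK : k ≤ (F.P p.K).m + (F.P p.K).K := by rw [T4Family.P_K]; omega
  have hBK : 0 ≤ B₀ * K₀ (4 * 2 ^ (F.P p.K).d) (2 * (F.P p.K).d) := mul_nonneg hB₀ (K₀_pos _ _).le
  have hL0 : (0 : ℝ) ≤ ((F.P p.K).L : ℝ) := by positivity
  -- the canonical scale of a point of `Ω_j(s)` (as in file 11)
  have hsc : ∀ j, 1 ≤ j → j ≤ k → ∃ sc : Site (F.P p.K) j → ℕ, ∀ z ∈ Z j, (j ≤ sc z ∧ sc z ≤ k) ∧ toFine j z ∈ gammaRegion s.Ω k (sc z) := by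
    intro j hj hjk
    refine ⟨fun z => if hz : z ∈ Z j then Classical.choose (exists_scale_of_mem_Omega θ p s hj hjk (hZΩ j hj hjk z hz)) else j, fun z hz => ?_⟩
    simp only [dif_pos hz]
    obtain ⟨h1, h2, h3⟩ := Classical.choose_spec (exists_scale_of_mem_Omega θ p s hj hjk (hZΩ j hj hjk z hz))
    exact ⟨⟨h1, h2⟩, h3⟩
  choose! scE hscE using hsc
  refine ineq249_action23_at_record₁₃CoPH_of_sect3Sentences θ p s t a κ₀ hκ Ek EkLog EkRest hEk U cE cR (B₀ * K₀ (4 * 2 ^ (F.P p.K).d) (2 * (F.P p.K).d))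
    ((F.P p.K).L : ℝ) b E₂ _ hL hb hcE hcR hBK
    (fun _ _ _ => add_nonneg (Nat.cast_nonneg _) (Nat.cast_nonneg _)) hb' hγ4 hγ2 hRγ hI hlb hk Z h hφ hZ scE (fun j hj hjk z hz => (hscE j hj hjk z hz).1)
    (fun j hj hjk z hz => h367 j hj hjk z hz (scE j z) (hscE j hj hjk z hz).1.1 (hscE j hj hjk z hz).1.2 (hscE j hj hjk z hz).2)
    (fun j hj hjk n => ?_) hκR pick hpick scR (fun j hj hjk X hX => (hscR j hj hjk X hX).1) hr (fun j hj hjk n => ?_) (fun j _ => j)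
    (fun j hj _ X _ => ⟨hj, le_rfl⟩)
    (fun n => ((univ.filter fun c : TPt (F.P p.K).d (Sect2.domCount (F.P p.K) θ.τ9.M n) =>
          (Sect2.domSites (F.P p.K) θ.τ9.M n (Sect2.cubeDom (F.P p.K) θ.τ9.M n c) ∩
              Sect2.enlT (F.P p.K) (Sect2.zSide (F.P p.K) θ.ν θ.τ9.M (gOfRecord₁₃ F N θ.toStage13Params p) n) 1 (s.Λ n)ᶜ).Nonempty ∧
            ∃ c', (c' = c ∨ TAdj c' c) ∧ (Sect2.domSites (F.P p.K) θ.τ9.M n (Sect2.cubeDom (F.P p.K) θ.τ9.M n c') ∩ s.Ω n).Nonempty).card : ℝ))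
    (fun n _ _ => Nat.cast_nonneg _) (fun n _ _ => le_add_of_nonneg_left (Nat.cast_nonneg _)) (fun n j hn hnj hjk => ?_) hvac
  · -- the 𝐄-side count at scale n, weakened to the volumes Γ′
    have hfac : 0 ≤ ((((F.P p.K).L : ℝ) ^ ((n : ℝ) - j)) ^ (4 : ℝ)) := Real.rpow_nonneg (Real.rpow_nonneg hL0 _) _
    by_cases hn : j ≤ n ∧ n ≤ k
    · exact (hcount_at_record₁₃ θ p s hj hn.1 (hn.2.trans hkmK) (Z j) (scE j) fun z hz hzn => by
        rw [← hzn]; exact (hscE j hj hjk z hz).2).trans (mul_le_mul_of_nonneg_left (le_add_of_nonneg_right (Nat.cast_nonneg _)) hfac)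
    · have h0 : ((Z j).filter fun z => scE j z = n) = ∅ := by
        refine Finset.filter_false_of_mem fun z hz hzn => hn ?_
        rw [← hzn]; exact (hscE j hj hjk z hz).1
      rw [h0, Finset.card_empty, Nat.cast_zero]
      exact mul_nonneg hfac (add_nonneg (Nat.cast_nonneg _) (Nat.cast_nonneg _))
  · -- the 𝐑-side count at scale n, weakened to the volumes Γ′
    have hfac : 0 ≤ ((((F.P p.K).L : ℝ) ^ ((n : ℝ) - j)) ^ (4 : ℝ)) := Real.rpow_nonneg (Real.rpow_nonneg hL0 _) _
    by_cases hn : j ≤ n ∧ n ≤ k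
    · refine (hcountR_at_record₁₃ θ p s hj hn.1 (hn.2.trans hkmK) hM _ (scR j) fun x hx hxn => ?_).trans
        (mul_le_mul_of_nonneg_left (le_add_of_nonneg_right (Nat.cast_nonneg _)) hfac)
      obtain ⟨X, hX, rfl⟩ := Finset.mem_image.mp hx
      have hX' := (Finset.mem_filter.mp hX).2
      rw [← hxn]; exact (hscR j hj hjk X hX').2
    · have h0 : (((univ.filter fun X => Sect2.admR (F.P p.K) θ.ν θ.τ9.M (gOfRecord₁₃ F N θ.toStage13Params p) s.Λ j
          (Sect2.domSites (F.P p.K) θ.τ9.M j X) = true).image (pick j)).filter fun z => scR j z = n) = ∅ := by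
        refine Finset.filter_false_of_mem fun x hx hxn => hn ?_
        obtain ⟨X, hX, rfl⟩ := Finset.mem_image.mp hx
        rw [← hxn]; exact (hscR j hj hjk X (Finset.mem_filter.mp hX).2).1
      rw [h0, Finset.card_empty, Nat.cast_zero]
      exact mul_nonneg hfac (add_nonneg (Nat.cast_nonneg _) (Nat.cast_nonneg _))
  · -- the 𝐁-side: (2.42) termwise ⇒ the diagonal (2.47) (file 12)
    by_cases hjn : j = n
    · subst hjn
      have hB := bScale_abs_le_ringCard_of_ineq242 θ p s t a U hn hjk (hjk.trans hkmK) hM hκB hB₀ (h242 j hn hjk)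
      have h2 : (2 : ℝ) ^ (-((j : ℝ) - j)) = 1 := by rw [sub_self, neg_zero, Real.rpow_zero]
      rw [h2, mul_one]
      refine le_of_eq_of_le ?_ hB
      congr 1
      refine Finset.sum_congr rfl fun X _ => ?_
      simp only [and_true]
    · have h0 : ∑ X : (Sect2.domSys (F.P p.K) θ.τ9.M j).Dom,
          (if Sect2.admB (F.P p.K) θ.ν θ.τ9.M (gOfRecord₁₃ F N θ.toStage13Params p) s.Ω s.Λ j (Sect2.domSites (F.P p.K) θ.τ9.M j X) = true ∧ j = n then
            (t.B j X (Sect2.ofBackgroundC (ιSU N) U) a).re else 0) = 0 :=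
        Finset.sum_eq_zero fun X _ => by rw [if_neg (fun h => hjn h.2)]
      rw [h0, abs_zero]
      exact mul_nonneg (mul_nonneg hBK (Real.rpow_pos_of_pos two_pos _).le) (Nat.cast_nonneg _)

end Summit.QuantumFields.YangMills.Theorems.BalabanUVNodesN11Thm2Ineq249AtRecord13CoPHOfIneq242

end
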